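import Summits.QuantumFields.YangMills.Theorems.LuscherReductionDressedRitzPolyakovLiftBasisGenericL
import Summits.QuantumFields.YangMills.Theorems.LuscherReductionDressedRitzPolyakovLiftTransplantRootR
import HarnessLib

/-!
# «static-matching» rev 6 — the SCALE ∧ FORM cut of S-UNIV, BASIS-GENERIC (`…ForL P`) and in RATIO FORM
# (crux-ideate #1, seat ym-cruxidea-20205-1 GEN 4, on stmt-QuantumFields-20205 `LuscherReduction.DressedRitz`, line «polyakovlift»)

Skeleton of record r7 `b06d67d4467729f8` (LEAD ym-lead-20205-polyakovlift g2, 2026-08-27T20:36:45Z): the load-bearing fine-side RG stub is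
`Stmt.stub_universality : ∀ k, ChannelUniversalityForL (TransplantBasisLR k)` — the text `ChannelUniversalityForL P` of
`Theorems/LuscherReductionDressedRitzPolyakovLiftBasisGenericL.lean` at the basis predicate `P := TransplantBasisLR` (cut-off harmonic transplants).
Revs 1–5 of this card (tree `Cruxes/DressedRitz/Ideas/static-matching.md`, workfile `Cruxes/DressedRitz/StaticMatchingR5.lean`) were keyed to the RETIRED
basis currency `LiftBasis (liftCoupling β L) k ω g` of r3∕r5 and stated the static match in ABSOLUTE form (`fine variance = 1 ± C·lam'`, correct only for
one-site-orthonormal eigen-ratio bases).  Rev 6 re-types the cut ONCE for EVERY basis predicate `P : ℕ → ℝ → (Fin k → _) → Prop` (so it applies to r7 and to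
any later re-pinning of the basis verbatim) and in RATIO form:

* `StaticMatchAt lam' C β φ e₀ g` — TIME-0 UNIVERSALITY, channel by channel: the fine vacuum variance of the UNDRESSED lift `u⁰_i = liftVec β φ g_i`
  (flowed Polyakov holonomy insertion on the raw vacuum `φ`) equals the one-site vacuum variance of its UNDRESSED shadow `v_i = rawShadowVec L e₀ g_i
  = ins_{e₀}(g_i ∘ powLink L)` to RELATIVE precision `C·lam'` (`|‖u⁰_i‖² − ‖v_i‖²| ≤ C·lam'·‖v_i‖²`).  No reference value `1`, hence no one-site
  semiclassics inside: the comparison is fine law vs one-site law of the same test function, exactly what a Bałaban-type RG + Born–Oppenheimer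
  hand-over delivers at time 0, and insensitive to how the basis is normalised or cut off (r7's radius bookkeeping `1 ≤ R⁴Λ`, `RΛ ≤ 1/4` never enters).
* `ScaleUForL P` — SCALE: the static match holds AT THE LABEL `λ(β,L)` (shadow at `oneSiteCoupling β L = 2L³/λ³`) for every `P`-basis and every pair of
  raw vacua.  ONE static scalar per channel compared with the label: the whole coupling-constant calibration content of S-UNIV (tiered in `L` below).
* `ShapeUForL P C` — FORM, reparametrisation-invariant: at ANY trial parameter `lam' ∈ [λ/2, 2λ]`, static match at `lam'` for all `P`-bases at `lam'`
  ⇒ the r7 universality BODY (A5) ∧ (A6′) at `lam'` (shadow at `B(lam') = 2L³/lam'³`, tolerances `e^{C'lam'²/L}`, `C'lam'²/L`).  Its truth value is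
  invariant under `lam' ↦ lam'(1 + O(lam'))`; no coefficient of any running is inside.

PROVED here (0 sorry): `channelUniversalityForL_of_scale_shape : ScaleUForL P → (∀ C, 0 ≤ C → ShapeUForL P C) → ChannelUniversalityForL P` (modus
ponens at `lam' := λ(β,L)`; at the label `siteCouplingAt` IS `oneSiteCoupling` and `ChannelBodyAt` IS the tree body, `channelUniversalityForL_iff_label :=
Iff.rfl`); at `P := TransplantBasisLR` this is r7's `Stmt.stub_universality` character for character (`stubR7_universality_of_scale_shape`), and the re-cut
skeleton composes to the route decl BY NAME (`dressedRitz_of_scale_shape_partsForL`, `dressedRitz_of_scale_shape_partsR7`, through the tree's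
`dressedRitz_of_partsForL`); the `L`-tier ladder of SCALE (`ScaleUOnForL`, `tier0∕1∕2`, exact cover `scaleUForL_of_tiers`) is carried over.
Nothing is proposed to `Theorems/` and no registered stub is touched; the typed pieces are offered to the LEAD ∕ crux-plan for the re-cut
S-STAT″ := S-STAT ∧ (∀ k, ScaleUForL (P k)), S-UNIV″ := ∀ k C, 0 ≤ C → ShapeUForL (P k) C (owner DEDUP ruling: LEAD's pen).
-/

set_option autoImplicit false

noncomputable section

open MeasureTheory Real
open Literature.MathematicalPhysics.QuantumFieldTheory (GaugeConfig Edge)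
open scoped BigOperators

namespace Summit.QuantumFields.YangMills.Cruxes.DressedRitz.StaticMatching.ForL

open Summit.QuantumFields.YangMills.Theorems.FemtoTransferGap
open Summit.QuantumFields.YangMills.Theorems.FemtoTransferGap.PolyakovLift

variable {k : ℕ}

/-! ## §1 Objects: trial one-site coupling, undressed shadow, the ratio-form static match, the parametrised body -/

/-- One-site coupling at the BOX scale for a trial Lüscher parameter `lam'`: `B(lam') = 2L³/lam'³`. [cite: Luscher1983, §3] -/
def siteCouplingAt (lam' : ℝ) (L : ℕ) : ℝ := 2 * (L : ℝ) ^ 3 / lam' ^ 3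

/-- At the label the trial coupling IS the tree's `oneSiteCoupling` (definitional). [folklore] -/
theorem siteCouplingAt_label (β : ℝ) (L : ℕ) : siteCouplingAt (luscherLambda β L) L = oneSiteCoupling β L := rfl

/-- The UNDRESSED (time-0) one-site shadow of a channel function: `v = ins_{e₀}(g ∘ powLink L)`; the tree's `shadowVec B L e₀ g` is `K_B^[dressSteps L] v`.
[cite: Luscher1983, §3] -/
def rawShadowVec (L : ℕ) (e₀ : GaugeConfig 3 1 SU2 → ℝ) (g : GaugeConfig 3 1 SU2 → ℝ) : GaugeConfig 3 1 SU2 → ℝ :=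
  OpPlat.ins e₀ (g ∘ powLink L)

/-- `shadowVec B L e₀ g = K_B^[dressSteps L] (rawShadowVec L e₀ g)` (definitional). [folklore] -/
theorem shadowVec_eq_dress_rawShadowVec (B : ℝ) (L : ℕ) (e₀ g : GaugeConfig 3 1 SU2 → ℝ) :
    shadowVec B L e₀ g = (transferApply (L := 1) B)^[dressSteps L] (rawShadowVec L e₀ g) := rfl

/-- ★ STATIC MATCH at trial parameter `lam'`, RATIO FORM (time 0, one slice, no transfer operator): for every channel `i`, the fine vacuum variance of the
undressed lift `liftVec β φ g_i` equals the one-site vacuum variance of its undressed shadow `rawShadowVec L e₀ g_i` to relative precision `C·lam'`.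
Quadratic in `φ` and in `e₀` (sign-blind), degree-2 homogeneous in `g_i` on both sides (normalisation-blind); well-posed through `IsRawVacuum`'s `‖φ‖ = ‖e₀‖ = 1`.
[cite: Luscher1983, §3] [cite: LuscherWolff1990] -/
def StaticMatchAt {L : ℕ} [NeZero L] (lam' C : ℝ) (β : ℝ) (φ : GaugeConfig 3 L SU2 → ℝ) (e₀ : GaugeConfig 3 1 SU2 → ℝ)
    (g : Fin k → (GaugeConfig 3 1 SU2 → ℝ)) : Prop :=
  ∀ i : Fin k,
    |l2 (liftVec β φ (g i)) (liftVec β φ (g i)) - l2 (rawShadowVec L e₀ (g i)) (rawShadowVec L e₀ (g i))|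
      ≤ C * lam' * l2 (rawShadowVec L e₀ (g i)) (rawShadowVec L e₀ (g i))

/-- The r7 universality BODY (A5) ∧ (A6′) at trial parameter `lam'`: verbatim the body of `ChannelUniversalityForL` with `oneSiteCoupling β L ↦ siteCouplingAt lam' L`
and `luscherLambda β L ↦ lam'` (degree-0 homogeneous in each family). [cite: Luscher1983, §3] [cite: LuscherWolff1990] -/
def ChannelBodyAt (lam' C : ℝ) {L : ℕ} [NeZero L] (β : ℝ)
    (u : Fin k → (GaugeConfig 3 L SU2 → ℝ)) (w : Fin k → (GaugeConfig 3 1 SU2 → ℝ)) : Prop :=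
  (∀ i : Fin k,
    l2 (u i) (transferApply β (u i)) * l2 (w i) (w i) * levelValue su2Rep 1 (siteCouplingAt lam' L) 0 ≤
        Real.exp (C * lam' ^ 2 / L) *
          (l2 (w i) (transferApply (siteCouplingAt lam' L) (w i)) * l2 (u i) (u i) * levelValue su2Rep L β 0) ∧
    l2 (w i) (transferApply (siteCouplingAt lam' L) (w i)) * l2 (u i) (u i) * levelValue su2Rep L β 0 ≤
        Real.exp (C * lam' ^ 2 / L) *
          (l2 (u i) (transferApply β (u i)) * l2 (w i) (w i) * levelValue su2Rep 1 (siteCouplingAt lam' L) 0)) ∧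
  (∀ i l : Fin k, i ≠ l →
    |(l2 (u i) (transferApply β (u l)) -
        (l2 (u i) (transferApply β (u i)) / l2 (u i) (u i) + l2 (u l) (transferApply β (u l)) / l2 (u l) (u l)) / 2 *
          l2 (u i) (u l)) * levelValue su2Rep 1 (siteCouplingAt lam' L) 0 * (Real.sqrt (l2 (w i) (w i)) * Real.sqrt (l2 (w l) (w l))) -
      (l2 (w i) (transferApply (siteCouplingAt lam' L) (w l)) -
        (l2 (w i) (transferApply (siteCouplingAt lam' L) (w i)) / l2 (w i) (w i) +
            l2 (w l) (transferApply (siteCouplingAt lam' L) (w l)) / l2 (w l) (w l)) / 2 * l2 (w i) (w l)) * levelValue su2Rep L β 0 *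
        (Real.sqrt (l2 (u i) (u i)) * Real.sqrt (l2 (u l) (u l)))|
      ≤ C * (lam' ^ 2 / L) * levelValue su2Rep L β 0 * levelValue su2Rep 1 (siteCouplingAt lam' L) 0 *
        (Real.sqrt (l2 (u i) (u i)) * Real.sqrt (l2 (u l) (u l))) * (Real.sqrt (l2 (w i) (w i)) * Real.sqrt (l2 (w l) (w l))))

/-! ## §2 The two pieces, for an arbitrary basis predicate `P` -/

/-- ★ SCALE (`ScaleUForL P`): the ratio-form static match holds AT THE LABEL `λ(β,L)` for every `P`-basis at the label and every pair of raw vacua (fine at `β`,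
one-site at `oneSiteCoupling β L`).  ONE static scalar per channel compared with the label: where all coupling-constant renormalisation (the two-loop definition of
`luscherLambda`) is visible. [cite: Luscher1983, §3] [cite: Balaban1987RG1, Thm 2] -/
def ScaleUForL (P : ℕ → ℝ → (Fin k → (GaugeConfig 3 1 SU2 → ℝ)) → Prop) : Prop :=
  ∃ C lam0 : ℝ, 0 ≤ C ∧ 0 < lam0 ∧ ∀ lam : ℝ, 0 < lam → lam ≤ lam0 → ∃ L0 : ℕ,
    ∀ (L : ℕ) [NeZero L], L0 ≤ L → ∀ β : ℝ, InFemtoWindow lam β L →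
      ∀ φ : GaugeConfig 3 L SU2 → ℝ, IsRawVacuum β φ →
        ∀ g : Fin k → (GaugeConfig 3 1 SU2 → ℝ), P L (luscherLambda β L) g →
          ∀ e₀ : GaugeConfig 3 1 SU2 → ℝ, IsRawVacuum (L := 1) (oneSiteCoupling β L) e₀ →
            StaticMatchAt (luscherLambda β L) C β φ e₀ g

/-- ★ FORM (`ShapeUForL P C`, answering to a static-match constant `C`): for every trial parameter `lam' ∈ [λ/2, 2λ]`, IF every `P`-basis at `lam'` is statically
matched at `lam'` against every one-site raw vacuum at `B(lam')`, THEN for every `P`-basis at `lam'` and every such vacuum the body (A5) ∧ (A6′) holds at `lam'`.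
Reparametrisation-invariant: the effective-theory FORM (Born–Oppenheimer universality of the zero-mode dynamics given the static width), no calibration.
[cite: Luscher1983, §3] [cite: LuscherWolff1990] [cite: Balaban1987RG1, Thm 1] -/
def ShapeUForL (P : ℕ → ℝ → (Fin k → (GaugeConfig 3 1 SU2 → ℝ)) → Prop) (C : ℝ) : Prop :=
  ∃ C' lam0 : ℝ, 0 ≤ C' ∧ 0 < lam0 ∧ ∀ lam : ℝ, 0 < lam → lam ≤ lam0 → ∃ L0 : ℕ,
    ∀ (L : ℕ) [NeZero L], L0 ≤ L → ∀ β : ℝ, InFemtoWindow lam β L →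
      ∀ φ : GaugeConfig 3 L SU2 → ℝ, IsRawVacuum β φ →
        ∀ lam' : ℝ, luscherLambda β L / 2 ≤ lam' → lam' ≤ 2 * luscherLambda β L →
          (∀ g : Fin k → (GaugeConfig 3 1 SU2 → ℝ), P L lam' g →
              ∀ e₀ : GaugeConfig 3 1 SU2 → ℝ, IsRawVacuum (L := 1) (siteCouplingAt lam' L) e₀ → StaticMatchAt lam' C β φ e₀ g) →
          ∀ g : Fin k → (GaugeConfig 3 1 SU2 → ℝ), P L lam' g →
            ∀ e₀ : GaugeConfig 3 1 SU2 → ℝ, IsRawVacuum (L := 1) (siteCouplingAt lam' L) e₀ →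
              ChannelBodyAt lam' C' β (dressedLiftFamily β φ g) (shadowFamily (siteCouplingAt lam' L) L e₀ g)

/-- At the label the parametrised body IS the tree's `ChannelUniversalityForL P` body (definitional: `let`s zeta-reduce, `siteCouplingAt_label` is `rfl`). [folklore] -/
theorem channelUniversalityForL_iff_label (P : ℕ → ℝ → (Fin k → (GaugeConfig 3 1 SU2 → ℝ)) → Prop) :
    ChannelUniversalityForL P ↔
      ∃ C lam0 : ℝ, 0 ≤ C ∧ 0 < lam0 ∧ ∀ lam : ℝ, 0 < lam → lam ≤ lam0 → ∃ L0 : ℕ,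
        ∀ (L : ℕ) [NeZero L], L0 ≤ L → ∀ β : ℝ, InFemtoWindow lam β L →
          ∀ φ : GaugeConfig 3 L SU2 → ℝ, IsRawVacuum β φ →
            ∀ g : Fin k → (GaugeConfig 3 1 SU2 → ℝ), P L (luscherLambda β L) g →
              ∀ e₀ : GaugeConfig 3 1 SU2 → ℝ, IsRawVacuum (L := 1) (oneSiteCoupling β L) e₀ →
                ChannelBodyAt (luscherLambda β L) C β (dressedLiftFamily β φ g) (shadowFamily (oneSiteCoupling β L) L e₀ g) :=
  Iff.rfl

/-! ## §3 ★ The glue: SCALE ∧ FORM ⇒ UNIVERSALITY, for any basis predicate (PROVED) -/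

/-- ★ **`ScaleUForL P → (∀ C, 0 ≤ C → ShapeUForL P C) → ChannelUniversalityForL P`** — modus ponens at `lam' := λ(β,L)` (constants `C'`, `min lam0`, `max L0`).
[cite: Luscher1983, §3] -/
theorem channelUniversalityForL_of_scale_shape {P : ℕ → ℝ → (Fin k → (GaugeConfig 3 1 SU2 → ℝ)) → Prop}
    (hScale : ScaleUForL P) (hShape : ∀ C, 0 ≤ C → ShapeUForL P C) : ChannelUniversalityForL P := by
  obtain ⟨C, lam0, hC, hlam0, hS⟩ := hScale
  obtain ⟨C', lam0', hC', hlam0', hSh⟩ := hShape C hC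
  rw [channelUniversalityForL_iff_label]
  refine ⟨C', min lam0 lam0', hC', lt_min hlam0 hlam0', ?_⟩
  intro lam hlam hle
  obtain ⟨L0, hL0⟩ := hS lam hlam (le_trans hle (min_le_left _ _))
  obtain ⟨L0', hL0'⟩ := hSh lam hlam (le_trans hle (min_le_right _ _))
  refine ⟨max L0 L0', ?_⟩
  intro L _ hL β hβ φ hφ g hg e₀ he₀
  have h1 := hL0 L (le_trans (le_max_left _ _) hL) β hβ φ hφ
  have h2 := hL0' L (le_trans (le_max_right _ _) hL) β hβ φ hφ (luscherLambda β L)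
  have hpos : 0 < luscherLambda β L := luscherLambda_pos_of_window hlam hβ
  have hlo : luscherLambda β L / 2 ≤ luscherLambda β L := by linarith
  have hhi : luscherLambda β L ≤ 2 * luscherLambda β L := by linarith
  exact h2 hlo hhi (fun g' hg' e₀' he₀' => h1 g' hg' e₀' he₀') g hg e₀ he₀

/-- The family version over a `k`-indexed predicate family `P k` (the shape of the registered stubs `∀ k, …ForL (P k)`). [cite: Luscher1983, §3] -/
theorem channelUniversalityForL_of_scale_shape_family {P : (k : ℕ) → ℕ → ℝ → (Fin k → (GaugeConfig 3 1 SU2 → ℝ)) → Prop}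
    (hScale : ∀ k, ScaleUForL (P k)) (hShape : ∀ k C, 0 ≤ C → ShapeUForL (P k) C) : ∀ k, ChannelUniversalityForL (P k) :=
  fun k => channelUniversalityForL_of_scale_shape (hScale k) (hShape k)

/-- ★★ The re-cut skeleton composes to the route decl BY NAME for any physical basis predicate family: S-STAT ∧ SCALE ∧ FORM ∧ S-PSCAL ∧ S-LEAK ⇒ `DressedRitz`
(tree `dressedRitz_of_partsForL`). [cite: Luscher1983, §3] [cite: LuscherWolff1990] -/
theorem dressedRitz_of_scale_shape_partsForL {P : (k : ℕ) → ℕ → ℝ → (Fin k → (GaugeConfig 3 1 SU2 → ℝ)) → Prop} (hP : ∀ k, BasisPhysL (P k))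
    (hS : ∀ k, StaticsForL (P k)) (hScale : ∀ k, ScaleUForL (P k)) (hShape : ∀ k C, 0 ≤ C → ShapeUForL (P k) C)
    (hB : ∀ k, PScalingExistsForL (P k)) (hK : ∀ k, LeakageForL (P k)) :
    Summit.QuantumFields.YangMills.Theses.LuscherReduction.DressedRitz :=
  dressedRitz_of_partsForL (P := P) hP hS (channelUniversalityForL_of_scale_shape_family hScale hShape) hB hK

/-! ## §4 At the r7 basis predicate `TransplantBasisLR` (skeleton of record `b06d67d4467729f8`) -/

/-- r7's registered S-UNIV text, character for character (`Lines-polyakovlift-r7.lean`: `Stmt.stub_universality := ∀ k, ChannelUniversalityForL (TransplantBasisLR k)`). -/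
abbrev StmtR7_stub_universality : Prop := ∀ k : ℕ, ChannelUniversalityForL (TransplantBasisLR k)

/-- ★ SCALE ∧ FORM at `TransplantBasisLR` ⇒ r7's `Stmt.stub_universality`. [cite: Luscher1983, §3] -/
theorem stubR7_universality_of_scale_shape (hScale : ∀ k, ScaleUForL (TransplantBasisLR k))
    (hShape : ∀ k C, 0 ≤ C → ShapeUForL (TransplantBasisLR k) C) : StmtR7_stub_universality :=
  channelUniversalityForL_of_scale_shape_family (P := TransplantBasisLR) hScale hShape

/-- ★★ The re-cut r7 skeleton composes to `DressedRitz` BY NAME (members physical by the tree's `basisPhysL_transplantBasisLR`). [cite: Luscher1983, §3] [cite: LuscherWolff1990] -/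
theorem dressedRitz_of_scale_shape_partsR7 (hS : ∀ k, StaticsForL (TransplantBasisLR k))
    (hScale : ∀ k, ScaleUForL (TransplantBasisLR k)) (hShape : ∀ k C, 0 ≤ C → ShapeUForL (TransplantBasisLR k) C)
    (hB : ∀ k, PScalingExistsForL (TransplantBasisLR k)) (hK : ∀ k, LeakageForL (TransplantBasisLR k)) :
    Summit.QuantumFields.YangMills.Theses.LuscherReduction.DressedRitz :=
  dressedRitz_of_scale_shape_partsForL (P := TransplantBasisLR) basisPhysL_transplantBasisLR hS hScale hShape hB hK

/-! ## §5 The `L`-ladder of SCALE at fixed `lam` (loop-order ledger, typed; carried over from rev 5)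

* tier 0 `log L ≤ 1/(16 b₀ lam²)`      — NO β-function coefficient visible at the clause precision (label = bare parameter ± λ²; the running `2b₀g₀² log L ≤ λ/8`
  is inside the `O(λ)` slack): UV stability + bounded one-loop width correction only;
* tier 1 `1/(16 b₀ lam²) < log L ≤ exp(1/lam²)` — `b₀` exact, `b₁` invisible: one-loop asymptotic scaling of one static observable;
* tier 2 `exp(1/lam²) < log L`          — `b₀` AND `b₁` exact: two-loop asymptotic scaling (the owner's candidate shared item `TwoLoopFlowSU2` is its supplier).
`scaleUForL_of_tiers` glues the three restricted statements back to `ScaleUForL P` (exact cover). -/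

/-- SCALE restricted to a regime `R lam L`. [cite: Balaban1987RG1, Thm 2] -/
def ScaleUOnForL (R : ℝ → ℕ → Prop) (P : ℕ → ℝ → (Fin k → (GaugeConfig 3 1 SU2 → ℝ)) → Prop) : Prop :=
  ∃ C lam0 : ℝ, 0 ≤ C ∧ 0 < lam0 ∧ ∀ lam : ℝ, 0 < lam → lam ≤ lam0 → ∃ L0 : ℕ,
    ∀ (L : ℕ) [NeZero L], L0 ≤ L → R lam L → ∀ β : ℝ, InFemtoWindow lam β L →
      ∀ φ : GaugeConfig 3 L SU2 → ℝ, IsRawVacuum β φ →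
        ∀ g : Fin k → (GaugeConfig 3 1 SU2 → ℝ), P L (luscherLambda β L) g →
          ∀ e₀ : GaugeConfig 3 1 SU2 → ℝ, IsRawVacuum (L := 1) (oneSiteCoupling β L) e₀ →
            StaticMatchAt (luscherLambda β L) C β φ e₀ g

/-- tier 0: the sub-window (no running visible). [cite: Luscher1983, §3] -/
def tier0 (lam : ℝ) (L : ℕ) : Prop := Real.log L ≤ 1 / (16 * b0 * lam ^ 2)

/-- tier 1: one-loop running visible, two-loop not. [cite: Luscher1983, §3] -/
def tier1 (lam : ℝ) (L : ℕ) : Prop := 1 / (16 * b0 * lam ^ 2) < Real.log L ∧ Real.log L ≤ Real.exp (1 / lam ^ 2)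

/-- tier 2: the doubly-exponential tail (two-loop running visible). [cite: Luscher1983, §3] -/
def tier2 (lam : ℝ) (L : ℕ) : Prop := Real.exp (1 / lam ^ 2) < Real.log L

/-- The three tiers cover. [folklore] -/
theorem tier_cover (lam : ℝ) (L : ℕ) : tier0 lam L ∨ tier1 lam L ∨ tier2 lam L := by
  unfold tier0 tier1 tier2
  rcases le_or_gt (Real.log L) (1 / (16 * b0 * lam ^ 2)) with h | h
  · exact Or.inl h
  · rcases le_or_gt (Real.log L) (Real.exp (1 / lam ^ 2)) with h' | h'
    · exact Or.inr (Or.inl ⟨h, h'⟩)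
    · exact Or.inr (Or.inr h')

/-- `StaticMatchAt` is monotone in its constant (for `0 ≤ lam'`; the right-hand side carries the nonnegative shadow variance). [folklore] -/
theorem staticMatchAt_mono {L : ℕ} [NeZero L] {lam' C C'' : ℝ} {β : ℝ} {φ : GaugeConfig 3 L SU2 → ℝ} {e₀ : GaugeConfig 3 1 SU2 → ℝ}
    {g : Fin k → (GaugeConfig 3 1 SU2 → ℝ)} (h : StaticMatchAt lam' C β φ e₀ g) (hC : C ≤ C'') (hl : 0 ≤ lam') :
    StaticMatchAt lam' C'' β φ e₀ g :=
  fun i => (h i).trans (mul_le_mul_of_nonneg_right (mul_le_mul_of_nonneg_right hC hl) (l2_self_nonneg _))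

/-- ★ The three tiers glue back to SCALE (exact cover; constants `max`, thresholds `min`∕`max`). [folklore] -/
theorem scaleUForL_of_tiers {P : ℕ → ℝ → (Fin k → (GaugeConfig 3 1 SU2 → ℝ)) → Prop}
    (h0 : ScaleUOnForL tier0 P) (h1 : ScaleUOnForL tier1 P) (h2 : ScaleUOnForL tier2 P) : ScaleUForL P := by
  obtain ⟨C0, l0, hC0, hl0, H0⟩ := h0
  obtain ⟨C1, l1, hC1, hl1, H1⟩ := h1
  obtain ⟨C2, l2', hC2, hl2, H2⟩ := h2
  refine ⟨max C0 (max C1 C2), min l0 (min l1 l2'), le_max_of_le_left hC0, lt_min hl0 (lt_min hl1 hl2), ?_⟩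
  intro lam hlam hle
  obtain ⟨L0, hL0⟩ := H0 lam hlam (hle.trans (min_le_left _ _))
  obtain ⟨L1, hL1⟩ := H1 lam hlam (hle.trans ((min_le_right _ _).trans (min_le_left _ _)))
  obtain ⟨L2, hL2⟩ := H2 lam hlam (hle.trans ((min_le_right _ _).trans (min_le_right _ _)))
  refine ⟨max L0 (max L1 L2), ?_⟩
  intro L _ hL β hβ φ hφ g hg e₀ he₀
  have hpos : 0 ≤ luscherLambda β L := (luscherLambda_pos_of_window hlam hβ).le
  rcases tier_cover lam L with t | t | t
  · exact staticMatchAt_mono (hL0 L ((le_max_left _ _).trans hL) t β hβ φ hφ g hg e₀ he₀) (le_max_left _ _) hpos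
  · exact staticMatchAt_mono (hL1 L (((le_max_left _ _).trans (le_max_right _ _)).trans hL) t β hβ φ hφ g hg e₀ he₀)
      ((le_max_left _ _).trans (le_max_right _ _)) hpos
  · exact staticMatchAt_mono (hL2 L (((le_max_right _ _).trans (le_max_right _ _)).trans hL) t β hβ φ hφ g hg e₀ he₀)
      ((le_max_right _ _).trans (le_max_right _ _)) hpos

/-! ## §6 Sanity: FORM with a constant below SCALE's is never invoked; SCALE ∧ FORM is a DECOMPOSITION of S-UNIV, not a transfer

The glue consumes `ShapeUForL P C` only at the constant `C` produced by `ScaleUForL P`; a FORM statement with a smaller constant has a premise SCALE does not supply and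
is simply not used.  Conversely `ChannelUniversalityForL P` gives `ShapeUForL P C` at `lam' = λ(β,L)` for every `C` only if the basis predicate and the one-site vacuum
at `lam'` are the label's — the `∀ lam'` is what makes FORM reparametrisation-invariant (no converse is claimed or needed). -/

/-- FORM is antitone in the static-match constant it answers to (a weaker premise serves a stronger one). [folklore] -/
theorem shapeUForL_anti {P : ℕ → ℝ → (Fin k → (GaugeConfig 3 1 SU2 → ℝ)) → Prop} {C C'' : ℝ} (hCC : C ≤ C'')
    (h : ShapeUForL P C'') : ShapeUForL P C := by
  obtain ⟨C', lam0, hC', hlam0, H⟩ := h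
  refine ⟨C', lam0, hC', hlam0, fun lam hlam hle => ?_⟩
  obtain ⟨L0, hL0⟩ := H lam hlam hle
  refine ⟨L0, fun L _ hL β hβ φ hφ lam' hlo hhi hstat => hL0 L hL β hβ φ hφ lam' hlo hhi ?_⟩
  intro g hg e₀ he₀
  have hpos : 0 < luscherLambda β L := luscherLambda_pos_of_window hlam hβ
  exact staticMatchAt_mono (hstat g hg e₀ he₀) hCC (by linarith)


/-! ## §7 Variant (B): ONE basis-free static observable — the thinnest calibration item

The coupling is ONE number, so the renormalisation condition should be ONE observable.  Fix a centre-even one-site class function `h` (canonical choice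
`polyakovProbe V = Σ_e (1 − (½ Re tr V_e)²) = Σ_e sin² θ_e`) and compare its fine vacuum MEAN on the flowed Polyakov holonomies with its one-site vacuum
mean on `powLink L` at the trial coupling `B(lam')`.  `ScaleOneForL h` is a SINGLE `Prop` — free of `k`, of the basis predicate and of every cut-off —
reading «the flowed-Polyakov finite-volume coupling obeys two-loop asymptotic scaling against the label `λ(β,L)` to relative `O(λ)`»; `ShapeOneForL h P C`
carries ALL universality (time 0, 1, 2) of the channel functions GIVEN the one static certificate.  Same modus-ponens glue. -/

/-- The canonical calibration probe `h_*(V) = Σ_e (1 − (½ Re tr V_e)²)` (`= Σ_e sin² θ_e`): bounded, a class function of each link, EVEN under the centre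
flips `V_e ↦ −V_e` (so zero-flux physical), of relative sensitivity `2` to the zero-mode scale. [cite: Luscher1983, §2] -/
def polyakovProbe (V : GaugeConfig 3 1 SU2) : ℝ :=
  ∑ e : Edge 3 1, (1 - (((su2Rep (V e)).trace).re / 2) ^ 2)

/-- Fine vacuum MEAN of `h` read on the flowed Polyakov holonomy triple (base point `0`, flow time `flowTime β L`): `⟨φ, (h ∘ Π_t)·φ⟩`. [cite: LuscherWolff1990] -/
def fineMean {L : ℕ} [NeZero L] (β : ℝ) (φ : GaugeConfig 3 L SU2 → ℝ) (h : GaugeConfig 3 1 SU2 → ℝ) : ℝ :=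
  l2 φ (flowLiftAt (L := L) 0 (flowTime β L) h * φ)

/-- One-site vacuum MEAN of `h ∘ powLink L`: `⟨e₀, (h ∘ powLink L)·e₀⟩`. [cite: Luscher1983, §3] -/
def shadowMean (L : ℕ) (e₀ : GaugeConfig 3 1 SU2 → ℝ) (h : GaugeConfig 3 1 SU2 → ℝ) : ℝ :=
  l2 e₀ ((h ∘ powLink L) * e₀)

/-- PROBE MATCH at trial parameter `lam'`: the fine mean of `h` equals its one-site shadow mean to relative precision `C·lam'`. [cite: Luscher1983, §3] -/
def ProbeMatchAt {L : ℕ} [NeZero L] (lam' C : ℝ) (β : ℝ) (φ : GaugeConfig 3 L SU2 → ℝ) (e₀ : GaugeConfig 3 1 SU2 → ℝ)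
    (h : GaugeConfig 3 1 SU2 → ℝ) : Prop :=
  |fineMean β φ h - shadowMean L e₀ h| ≤ C * lam' * |shadowMean L e₀ h|

/-- ★ SCALE¹ (`ScaleOneForL h`) — ONE Prop for the whole line: the probe `h` matches AT THE LABEL for every pair of raw vacua, deep in the femto window.
(Two-loop asymptotic scaling of one finite-volume flowed-Polyakov observable against the bare coupling.) [cite: Luscher1983, §3] [cite: Balaban1987RG1, Thm 2] -/
def ScaleOneForL (h : GaugeConfig 3 1 SU2 → ℝ) : Prop :=
  ∃ C lam0 : ℝ, 0 ≤ C ∧ 0 < lam0 ∧ ∀ lam : ℝ, 0 < lam → lam ≤ lam0 → ∃ L0 : ℕ,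
    ∀ (L : ℕ) [NeZero L], L0 ≤ L → ∀ β : ℝ, InFemtoWindow lam β L →
      ∀ φ : GaugeConfig 3 L SU2 → ℝ, IsRawVacuum β φ →
        ∀ e₀ : GaugeConfig 3 1 SU2 → ℝ, IsRawVacuum (L := 1) (oneSiteCoupling β L) e₀ →
          ProbeMatchAt (luscherLambda β L) C β φ e₀ h

/-- ★ FORM¹ (`ShapeOneForL h P C`): for every trial `lam' ∈ [λ/2, 2λ]`, probe match of `h` at `lam'` (against every one-site raw vacuum at `B(lam')`) ⇒ the
body (A5) ∧ (A6′) at `lam'` for every `P`-basis at `lam'`.  All Born–Oppenheimer universality of the channel functions, static and dynamic, GIVEN one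
static certificate; reparametrisation-invariant. [cite: Luscher1983, §3] [cite: LuscherWolff1990] [cite: Balaban1987RG1, Thm 1] -/
def ShapeOneForL (h : GaugeConfig 3 1 SU2 → ℝ) (P : ℕ → ℝ → (Fin k → (GaugeConfig 3 1 SU2 → ℝ)) → Prop) (C : ℝ) : Prop :=
  ∃ C' lam0 : ℝ, 0 ≤ C' ∧ 0 < lam0 ∧ ∀ lam : ℝ, 0 < lam → lam ≤ lam0 → ∃ L0 : ℕ,
    ∀ (L : ℕ) [NeZero L], L0 ≤ L → ∀ β : ℝ, InFemtoWindow lam β L →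
      ∀ φ : GaugeConfig 3 L SU2 → ℝ, IsRawVacuum β φ →
        ∀ lam' : ℝ, luscherLambda β L / 2 ≤ lam' → lam' ≤ 2 * luscherLambda β L →
          (∀ e₀ : GaugeConfig 3 1 SU2 → ℝ, IsRawVacuum (L := 1) (siteCouplingAt lam' L) e₀ → ProbeMatchAt lam' C β φ e₀ h) →
          ∀ g : Fin k → (GaugeConfig 3 1 SU2 → ℝ), P L lam' g →
            ∀ e₀ : GaugeConfig 3 1 SU2 → ℝ, IsRawVacuum (L := 1) (siteCouplingAt lam' L) e₀ →
              ChannelBodyAt lam' C' β (dressedLiftFamily β φ g) (shadowFamily (siteCouplingAt lam' L) L e₀ g)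

/-- ★ **`ScaleOneForL h → (∀ C, 0 ≤ C → ShapeOneForL h P C) → ChannelUniversalityForL P`** (modus ponens at the label). [cite: Luscher1983, §3] -/
theorem channelUniversalityForL_of_scaleOne_shapeOne {h : GaugeConfig 3 1 SU2 → ℝ}
    {P : ℕ → ℝ → (Fin k → (GaugeConfig 3 1 SU2 → ℝ)) → Prop}
    (hScale : ScaleOneForL h) (hShape : ∀ C, 0 ≤ C → ShapeOneForL h P C) : ChannelUniversalityForL P := by
  obtain ⟨C, lam0, hC, hlam0, hS⟩ := hScale
  obtain ⟨C', lam0', hC', hlam0', hSh⟩ := hShape C hC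
  rw [channelUniversalityForL_iff_label]
  refine ⟨C', min lam0 lam0', hC', lt_min hlam0 hlam0', ?_⟩
  intro lam hlam hle
  obtain ⟨L0, hL0⟩ := hS lam hlam (le_trans hle (min_le_left _ _))
  obtain ⟨L0', hL0'⟩ := hSh lam hlam (le_trans hle (min_le_right _ _))
  refine ⟨max L0 L0', ?_⟩
  intro L _ hL β hβ φ hφ g hg e₀ he₀
  have h1 := hL0 L (le_trans (le_max_left _ _) hL) β hβ φ hφ
  have h2 := hL0' L (le_trans (le_max_right _ _) hL) β hβ φ hφ (luscherLambda β L)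
  have hpos : 0 < luscherLambda β L := luscherLambda_pos_of_window hlam hβ
  have hlo : luscherLambda β L / 2 ≤ luscherLambda β L := by linarith
  have hhi : luscherLambda β L ≤ 2 * luscherLambda β L := by linarith
  exact h2 hlo hhi (fun e₀' he₀' => h1 e₀' he₀') g hg e₀ he₀

/-- ★★ Variant (B) composes to `DressedRitz` BY NAME for any physical basis predicate family, with ONE calibration Prop `ScaleOneForL h` for all `k`.
[cite: Luscher1983, §3] [cite: LuscherWolff1990] -/
theorem dressedRitz_of_scaleOne_shapeOne_partsForL (h : GaugeConfig 3 1 SU2 → ℝ)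
    {P : (k : ℕ) → ℕ → ℝ → (Fin k → (GaugeConfig 3 1 SU2 → ℝ)) → Prop} (hP : ∀ k, BasisPhysL (P k))
    (hS : ∀ k, StaticsForL (P k)) (hScale : ScaleOneForL h) (hShape : ∀ k C, 0 ≤ C → ShapeOneForL h (P k) C)
    (hB : ∀ k, PScalingExistsForL (P k)) (hK : ∀ k, LeakageForL (P k)) :
    Summit.QuantumFields.YangMills.Theses.LuscherReduction.DressedRitz :=
  dressedRitz_of_partsForL (P := P) hP hS (fun k => channelUniversalityForL_of_scaleOne_shapeOne hScale (hShape k)) hB hK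

/-- ★★ … and at r7's `TransplantBasisLR` with the canonical probe. [cite: Luscher1983, §3] [cite: LuscherWolff1990] -/
theorem dressedRitz_of_scaleOne_shapeOne_partsR7 (hS : ∀ k, StaticsForL (TransplantBasisLR k))
    (hScale : ScaleOneForL polyakovProbe) (hShape : ∀ k C, 0 ≤ C → ShapeOneForL polyakovProbe (TransplantBasisLR k) C)
    (hB : ∀ k, PScalingExistsForL (TransplantBasisLR k)) (hK : ∀ k, LeakageForL (TransplantBasisLR k)) :
    Summit.QuantumFields.YangMills.Theses.LuscherReduction.DressedRitz :=
  dressedRitz_of_scaleOne_shapeOne_partsForL polyakovProbe (P := TransplantBasisLR) basisPhysL_transplantBasisLR hS hScale hShape hB hK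

end Summit.QuantumFields.YangMills.Cruxes.DressedRitz.StaticMatching.ForL

end
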